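import Literature.MathematicalPhysics.QuantumFieldTheory.Balaban1983to89.Node00.SmallFieldDomOfRecord
import Literature.MathematicalPhysics.QuantumFieldTheory.Balaban1983to89.Node00.Record8Inhabited

/-!
# NODE 00 (YM-PLAN Track A) — THE FIXED-THRESHOLD SMALL-FIELD CHARACTERISTIC FUNCTIONS OF RECORD for the β-LAYER's χ SLOT
# ([Balaban1987RG1] (0.16) p. 255, (0.19) p. 256 «χ_k restricts the integral to small fluctuation fields», p. 259 ∕ (1.2) p. 260 the small-field
# domain «|∂U_k(V) − 1| < ε₀η²» and its second form «|∂V − 1| < ε₀ on T₁^{(k)}»): `chiFixOfRecord` ∕ `chiFixAltOfRecord` = THE INDICATORS OF def-R's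
# small-field DOMAINS OF RECORD (`domOfRecord` ∕ `domAltOfRecord`), `chiFix016OfRecord` = (0.16)'s block-contour form on the averaging of record's
# loop variables, the β-SLOT RE-KEYINGS `chiFixed7` ∕ `chiFixedBG7` (SAME TYPE as def-B's χ argument and as `chi7`; COUPLING-BLIND by typing), and
# `betaOfRecord₈χ θ` = Stage 8's β with ONLY the χ slot swapped (offered to the ₉∕₁₀ owners)

NODE 00 β-LAYER SUPPLY MODULE (request (R1) of the route's ONE WRITER, pub-ymgap plan g62 [WORD-BETA-REQUEST] 2026-08-26; INTERIM TYPER «def-χ» = seat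
`pub-ymgap-dag-n23-b` g2 by director-ym LINE №40∕№41; template owner def-R (`Node00/SmallFieldChiOfRecord.lean`, cited BY NAME, nothing restated); review-by-name
def-R ∕ def-T ∕ node00-def ∕ def-B).  APPEND-ONLY GROWTH: a NEW importing module; nothing landed is edited.
WHY (plan (I3-version) item (3), dag-n26-a's located finding): Stage 8 feeds def-B's β-layer (`effActionH ∕ mergedTerm ∕ betaMerged`) the χ of [III] (2.17),
`chi7 θ K g k := chiOfRecord F N θ.ν g K k`, whose cube partition has side `L^{k+1}M₂R_k(g_k)` with `R_k = RkOfRecord L r g_k` an ℕ-valued STEP FUNCTION of the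
running coupling — so the tree's β of record is g-DISCONTINUOUS across the thresholds of `R_k`, while print's β is a smooth function on `[0, γ]` read through
[I]'s own small-field characteristic functions, whose thresholds `ε₀`, `ε₁` are FIXED constants ([I] Thm 3 p. 264: «positive constants κ₀, M(κ), γ, ε₀, ε₁, α₀,
α₁»).  THIS FILE types the fixed-threshold χ's the β slot should read; which of them the next record plugs is the ₉∕₁₀ owner's switch.
WHAT IS DEFINED (definitions with bodies; TOTAL; no estimate; nothing of Bałaban's asserted):
* §1 `chiFixAltOfRecord ν K k : Density (F.P K) k (SU N)` — p. 259 SECOND printed form «|∂V − 1| < ε₀ on T₁^{(k)}» as a 0∕1 density on the step-`k` variable: the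
  INDICATOR of def-R's `domAltOfRecord ν K k` (`Setup.chiSmall Set.univ ν.ε₀`; threshold `Stage7Numerics.ε₀`, no residual, no background, no coupling);
  `chiFixOfRecord ν K k` — p. 259 FIRST printed form «|∂U_k(V) − 1| < ε₀η² on T_η» over node00-def-B's background of record `Uk … ν.εreg V`: the INDICATOR of
  def-R's `domOfRecord ν K k`; faces `…_eq_one_iff_mem` (χ = 1 ↔ V ∈ the domain), `…_nonneg`, `…_le_one`, `…_eq_zero_or_one`, `chiFixAltOfRecord_one`
  (χ(1) = 1 for `0 < ε₀`: non-degenerate at admissible numerics), the junk corner of the first form off the solvable set (= `mem_domOfRecord_of_not_ukExists`),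
  the bridges `…_eq_indicator` (χ = the domain's indicator, as functions), **`measurable_chiFixAltOfRecord`** (a THEOREM: plaquette variables and `dist1` are
  measurable on `SU(N)`) and `measurable_chiFixOfRecord_of` (the first form is measurable AS SOON AS `V ↦ U_k(V)` is — displayed, not a tree theorem).
* §2 `chiFix016OfRecord ε₀ K k` — (0.16)'s «Π_y Π_{x∈B(y)} χ({|U(y,x) − 1| < ε₀})» read with the loop variables of the averaging of record ((0.4) p. 253,
  `BlockAveraging.loopHol`; all coarse bonds `c`, all indices): `1` iff every loop variable is `ε₀`-close to the identity; faces `_eq_one_iff`, `_nonneg`, `_le_one`.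
* §3 THE β-SLOT RE-KEYINGS `chiFixed7 ν` (SECOND form — the template owner's keying, MEASURABLE by theorem: `measurable_chiFixed7`) and `chiFixedBG7 ν` (first form,
  over the background) `: (K : ℕ) → (ℕ → ℝ) → (k : ℕ) → Density (F.P K) k (SU N)` — the TYPE of def-B's χ argument (`effActionH ∕ mergedTerm ∕ mergedTermFamilyMat`)
  and of Stage 8's `chi7 θ`; they IGNORE the coupling sequence: `chiFixed7_flowBlind` ∕ `chiFixedBG7_flowBlind` (`rfl`) — coupling-continuity of the χ input BY TYPING.
* §4 `betaOfRecord₈χ θ : HBeta` — Stage 8's β of record `Record8.betaOfRecord₈` with ONLY the χ slot swapped to `chiFixed7 θ.ν` (same merged term family, chart,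
  basis, base histories, box radius): `oneLoopSplit_betaOfRecord₈χ` (the printed split BY CONSTRUCTION, as at Stage 8), `betaOfRecord₈χ_of_zeroChart` (the
  zero-chart collapse of `Record8Inhabited` is chart-side and transfers verbatim — the chart clause of `Record8Chart` is still what excludes it).  OFFERED:
  no record predicate is defined here (the ₉∕₁₀ owner decides whether the next record's β reads `chi7` or `chiFixed7`).
WHAT IS *NOT* HERE, DISPLAYED.  [I] (2.9) p. 266, verbatim: *«Finally we can define the characteristic function χ_k [=] Π_b χ({|B′(b)| < ε₁}). (2.9)  Another
possibility is to take g_kγ_kε₁ instead of ε₁, where γ_k = C log(L^kε)⁻¹ with C sufficiently large. It has the advantage that the functions E^{(j)}, β_j are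
analytic functions of the effective coupling constants, but it has some disadvantages in perturbative calculations also.»* — the literal (2.9) acts on the
FLUCTUATION variables `B′(b)` of the k-th step ((2.4)–(2.5): `V′(y,x) = 1 + B′(y,x) + …` around the background), which needs def-B's fluctuation chart
`U ↦ B′` around `Uk` — not a tree object yet (TODO([I] (2.9)): `chiFix29OfRecord ε₁ K k := Π_b 𝟙{‖B′(b)‖ < ε₁}` once the chart lands); the `g_kγ_kε₁` variant is
NOT adopted (it re-introduces the coupling into the threshold).  No estimate of [I] (Thm 3's restrictions on ε₀, ε₁) is asserted.
HONEST FRAMING: definitions + `rfl`∕`iff` bookkeeping; count-neutral; one finite four-torus family at fixed ε per run — NOT continuum ∕ ℝ⁴ ∕ OS ∕ mass gap ∕ Clay.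
-/

noncomputable section

open MeasureTheory
open scoped Matrix.Norms.L2Operator

namespace Literature.MathematicalPhysics.QuantumFieldTheory.Balaban1983to89.Node00

open T4Continuum (T4Family)
open T4FiniteEpsInhabited (zeroHBeta)
open FlowStep (HBeta)
open FlowStepRuns (genSeq)

variable (F : T4Family) (N : ℕ) [NeZero N]

/-! ## §1. The fixed-threshold small-field characteristic functions = the indicators of the small-field domains of record -/

/-- **χ of the small-field domain, SECOND printed form** — [I] p. 259: *«Another possible definition, technically less convenient, is given by the condition
|∂V − 1| < ε₀ on T₁^{(k)}»*, as a 0∕1 DENSITY on the step-`k` variable: `χ({|V(∂p) − 1| < ε₀, all p})` (`Setup.chiSmall` over all plaquettes; threshold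
`ν.ε₀` FIXED — no coupling, no background, no residual).  The indicator of def-R's `domAltOfRecord ν K k` (`chiFixAltOfRecord_eq_one_iff_mem`).
[cite: Balaban1987RG1, p.259 and (1.2) p.260] -/
def chiFixAltOfRecord (ν : Stage7Numerics) (K k : ℕ) : Density (F.P K) k (SU N) :=
  fun V => chiSmall Set.univ ν.ε₀ V

/-- **χ of the small-field domain, FIRST printed form** — [I] p. 259: *«such a domain is determined by the condition |∂U_k(V) − 1| < ε₀η² on T_η, for ε₀
sufficiently small»*, as a 0∕1 DENSITY on the step-`k` variable: `χ({|U_k(V)(∂p) − 1| < ε₀η_k², all p})` with `U_k(V)` = node00-def-B's background of record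
`Uk F N K k ν.εreg V` and `η_k = (F.P K).eta k`.  The indicator of def-R's `domOfRecord ν K k` (`chiFixOfRecord_eq_one_iff_mem`).
[cite: Balaban1987RG1, p.259 and (1.2) p.260] -/
def chiFixOfRecord (ν : Stage7Numerics) (K k : ℕ) : Density (F.P K) k (SU N) :=
  fun V => chiSmall Set.univ (ν.ε₀ * (F.P K).eta k ^ 2) (Uk F N K k ν.εreg V)

variable {F N}

/-- `χ ∈ {0, 1}` (second form). [cite: Balaban1987RG1, p.259 (bookkeeping)] -/
theorem chiFixAltOfRecord_eq_zero_or_one (ν : Stage7Numerics) (K k : ℕ) (V : GaugeField (F.P K) k (SU N)) :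
    chiFixAltOfRecord F N ν K k V = 0 ∨ chiFixAltOfRecord F N ν K k V = 1 := by
  unfold chiFixAltOfRecord chiSmall
  split_ifs
  · exact Or.inr rfl
  · exact Or.inl rfl

/-- `0 ≤ χ` (second form). [cite: Balaban1987RG1, p.259 (bookkeeping)] -/
theorem chiFixAltOfRecord_nonneg (ν : Stage7Numerics) (K k : ℕ) (V : GaugeField (F.P K) k (SU N)) : 0 ≤ chiFixAltOfRecord F N ν K k V := by
  rcases chiFixAltOfRecord_eq_zero_or_one ν K k V with h | h <;> rw [h]
  exact zero_le_one

/-- `χ ≤ 1` (second form). [cite: Balaban1987RG1, p.259 (bookkeeping)] -/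
theorem chiFixAltOfRecord_le_one (ν : Stage7Numerics) (K k : ℕ) (V : GaugeField (F.P K) k (SU N)) : chiFixAltOfRecord F N ν K k V ≤ 1 := by
  rcases chiFixAltOfRecord_eq_zero_or_one ν K k V with h | h <;> rw [h]
  exact zero_le_one

/-- **χ = 1 exactly on the small-field domain of record (second form)**: `χ(V) = 1 ↔ V ∈ domAltOfRecord ν K k` (`↔ PlaqSmall ν.ε₀ V`).
[cite: Balaban1987RG1, p.259] -/
theorem chiFixAltOfRecord_eq_one_iff_mem (ν : Stage7Numerics) (K k : ℕ) (V : GaugeField (F.P K) k (SU N)) :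
    chiFixAltOfRecord F N ν K k V = 1 ↔ V ∈ domAltOfRecord F N ν K k := by
  rw [mem_domAltOfRecord_iff]
  unfold chiFixAltOfRecord chiSmall
  constructor
  · intro h
    by_contra hV
    rw [if_neg (fun hS => hV fun p => hS p (Set.mem_univ p))] at h
    exact zero_ne_one h
  · intro hV
    rw [if_pos (show PlaqSmallOn Set.univ ν.ε₀ V from fun p _ => hV p)]

/-- **Non-degeneracy at admissible numerics**: at the unit configuration `χ(1) = 1` whenever `0 < ε₀` (every plaquette variable of `1` is `1`).
[cite: Balaban1987RG1, p.259 (bookkeeping)] -/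
theorem chiFixAltOfRecord_one (ν : Stage7Numerics) (hε : 0 < ν.ε₀) (K k : ℕ) : chiFixAltOfRecord F N ν K k 1 = 1 := by
  rw [chiFixAltOfRecord_eq_one_iff_mem, mem_domAltOfRecord_iff]
  intro q
  have hb : ∀ b, (1 : GaugeField (F.P K) k (SU N)) b = 1 := fun _ => rfl
  have h1 : GaugeField.plaqHol (1 : GaugeField (F.P K) k (SU N)) q = 1 := by simp [GaugeField.plaqHol, hb]
  rw [h1, GaugeGroup.dist1_one]
  exact hε

/-- `χ ∈ {0, 1}` (first form). [cite: Balaban1987RG1, p.259 (bookkeeping)] -/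
theorem chiFixOfRecord_eq_zero_or_one (ν : Stage7Numerics) (K k : ℕ) (V : GaugeField (F.P K) k (SU N)) :
    chiFixOfRecord F N ν K k V = 0 ∨ chiFixOfRecord F N ν K k V = 1 := by
  unfold chiFixOfRecord chiSmall
  split_ifs
  · exact Or.inr rfl
  · exact Or.inl rfl

/-- `0 ≤ χ` (first form). [cite: Balaban1987RG1, p.259 (bookkeeping)] -/
theorem chiFixOfRecord_nonneg (ν : Stage7Numerics) (K k : ℕ) (V : GaugeField (F.P K) k (SU N)) : 0 ≤ chiFixOfRecord F N ν K k V := by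
  rcases chiFixOfRecord_eq_zero_or_one ν K k V with h | h <;> rw [h]
  exact zero_le_one

/-- `χ ≤ 1` (first form). [cite: Balaban1987RG1, p.259 (bookkeeping)] -/
theorem chiFixOfRecord_le_one (ν : Stage7Numerics) (K k : ℕ) (V : GaugeField (F.P K) k (SU N)) : chiFixOfRecord F N ν K k V ≤ 1 := by
  rcases chiFixOfRecord_eq_zero_or_one ν K k V with h | h <;> rw [h]
  exact zero_le_one

/-- **χ = 1 exactly on the small-field domain of record (first form)**: `χ(V) = 1 ↔ V ∈ domOfRecord ν K k`
(`↔ PlaqSmall (ν.ε₀·η_k²) (Uk … V)`). [cite: Balaban1987RG1, p.259] -/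
theorem chiFixOfRecord_eq_one_iff_mem (ν : Stage7Numerics) (K k : ℕ) (V : GaugeField (F.P K) k (SU N)) :
    chiFixOfRecord F N ν K k V = 1 ↔ V ∈ domOfRecord F N ν K k := by
  rw [mem_domOfRecord_iff]
  unfold chiFixOfRecord chiSmall
  constructor
  · intro h
    by_contra hV
    rw [if_neg (fun hS => hV fun p => hS p (Set.mem_univ p))] at h
    exact zero_ne_one h
  · intro hV
    rw [if_pos (show PlaqSmallOn Set.univ (ν.ε₀ * (F.P K).eta k ^ 2) (Uk F N K k ν.εreg V) from fun p _ => hV p)]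

/-- The documented JUNK CORNER of the first form (= `mem_domOfRecord_of_not_ukExists`): off node00-def-B's solvable set the background is `1`, so `χ(V) = 1`
for `0 < ε₀η_k²` — print's domain is meant on the solvable set (admissibility ∕ the ₉ provisos decide what is read there). [cite: Balaban1987RG1, p.259 (typing convention)] -/
theorem chiFixOfRecord_of_not_ukExists (ν : Stage7Numerics) (K k : ℕ) (V : GaugeField (F.P K) k (SU N)) (h : ¬ UkExists F N K k ν.εreg V)
    (hε : 0 < ν.ε₀ * (F.P K).eta k ^ 2) : chiFixOfRecord F N ν K k V = 1 :=
  (chiFixOfRecord_eq_one_iff_mem ν K k V).2 (mem_domOfRecord_of_not_ukExists F N ν K k V h hε)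

/-- The second-form χ IS the indicator of def-R's second-form domain (as functions). [cite: Balaban1987RG1, p.259 (bookkeeping)] -/
theorem chiFixAltOfRecord_eq_indicator (ν : Stage7Numerics) (K k : ℕ) :
    chiFixAltOfRecord F N ν K k = (domAltOfRecord F N ν K k).indicator 1 := by
  funext V
  by_cases hV : V ∈ domAltOfRecord F N ν K k
  · rw [Set.indicator_of_mem hV, Pi.one_apply]
    exact (chiFixAltOfRecord_eq_one_iff_mem ν K k V).2 hV
  · rw [Set.indicator_of_notMem hV]
    rcases chiFixAltOfRecord_eq_zero_or_one ν K k V with h | h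
    · exact h
    · exact absurd ((chiFixAltOfRecord_eq_one_iff_mem ν K k V).1 h) hV

/-- **The second-form χ is MEASURABLE** — a THEOREM here (plaquette variables are measurable, `dist1` is measurable on `SU(N)`; unlike `chiOfRecord`, no
(2.12) minimiser is read).  The plan's S2 face. [cite: Balaban1987RG1, p.259 (bookkeeping)] -/
theorem measurable_chiFixAltOfRecord (ν : Stage7Numerics) (K k : ℕ) : Measurable (chiFixAltOfRecord F N ν K k) := by
  have hS : MeasurableSet {U : GaugeField (F.P K) k (SU N) | PlaqSmallOn Set.univ ν.ε₀ U} := by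
    have h : {U : GaugeField (F.P K) k (SU N) | PlaqSmallOn Set.univ ν.ε₀ U} =
        ⋂ p : Plaq (F.P K) k, {U | GaugeGroup.dist1 (GaugeField.plaqHol U p) < ν.ε₀} := by
      ext U
      simp only [PlaqSmallOn, Set.mem_univ, forall_const, Set.mem_setOf_eq, Set.mem_iInter]
    rw [h]
    exact MeasurableSet.iInter fun p =>
      measurableSet_lt (RegularGaugeGroup.measurable_dist1.comp (Missing.measurable_plaqHol p)) measurable_const
  unfold chiFixAltOfRecord chiSmall
  exact Measurable.ite hS measurable_const measurable_const

/-- def-R's second-form small-field domain is a measurable set (same plumbing). [cite: Balaban1987RG1, p.259 (bookkeeping)] -/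
theorem measurableSet_domAltOfRecord (ν : Stage7Numerics) (K k : ℕ) : MeasurableSet (domAltOfRecord F N ν K k) := by
  have h : domAltOfRecord F N ν K k = ⋂ p : Plaq (F.P K) k, {U | GaugeGroup.dist1 (GaugeField.plaqHol U p) < ν.ε₀} := by
    ext U
    simp only [mem_domAltOfRecord_iff, PlaqSmall, Set.mem_setOf_eq, Set.mem_iInter]
  rw [h]
  exact MeasurableSet.iInter fun p =>
    measurableSet_lt (RegularGaugeGroup.measurable_dist1.comp (Missing.measurable_plaqHol p)) measurable_const

/-- The first-form χ IS the indicator of def-R's first-form domain. [cite: Balaban1987RG1, p.259 (bookkeeping)] -/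
theorem chiFixOfRecord_eq_indicator (ν : Stage7Numerics) (K k : ℕ) :
    chiFixOfRecord F N ν K k = (domOfRecord F N ν K k).indicator 1 := by
  funext V
  by_cases hV : V ∈ domOfRecord F N ν K k
  · rw [Set.indicator_of_mem hV, Pi.one_apply]
    exact (chiFixOfRecord_eq_one_iff_mem ν K k V).2 hV
  · rw [Set.indicator_of_notMem hV]
    rcases chiFixOfRecord_eq_zero_or_one ν K k V with h | h
    · exact h
    · exact absurd ((chiFixOfRecord_eq_one_iff_mem ν K k V).1 h) hV

/-- The first-form χ is measurable AS SOON AS the background map `V ↦ U_k(V)` of record is (DISPLAYED: a measurable selection of the (2.12) minimisers is not a tree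
theorem — chair R447's LOCATED COST 1; the second form needs nothing). [cite: Balaban1987RG1, p.259 (bookkeeping)] -/
theorem measurable_chiFixOfRecord_of (ν : Stage7Numerics) (K k : ℕ) (hUk : Measurable (Uk F N K k ν.εreg)) :
    Measurable (chiFixOfRecord F N ν K k) := by
  have hS : MeasurableSet {U : GaugeField (F.P K) 0 (SU N) | PlaqSmallOn Set.univ (ν.ε₀ * (F.P K).eta k ^ 2) U} := by
    have h : {U : GaugeField (F.P K) 0 (SU N) | PlaqSmallOn Set.univ (ν.ε₀ * (F.P K).eta k ^ 2) U} =
        ⋂ p : Plaq (F.P K) 0, {U | GaugeGroup.dist1 (GaugeField.plaqHol U p) < ν.ε₀ * (F.P K).eta k ^ 2} := by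
      ext U
      simp only [PlaqSmallOn, Set.mem_univ, forall_const, Set.mem_setOf_eq, Set.mem_iInter]
    rw [h]
    exact MeasurableSet.iInter fun p =>
      measurableSet_lt (RegularGaugeGroup.measurable_dist1.comp (Missing.measurable_plaqHol p)) measurable_const
  have hχ : Measurable (chiSmall Set.univ (ν.ε₀ * (F.P K).eta k ^ 2) : GaugeField (F.P K) 0 (SU N) → ℝ) := by
    unfold chiSmall
    exact Measurable.ite hS measurable_const measurable_const
  exact hχ.comp hUk

/-! ## §2. (0.16)'s block-contour form on the loop variables of the averaging of record -/

variable (F N)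

open Classical in
/-- **(0.16)'s characteristic function, contour form** — [I] (0.16) p. 255: *«Π_{y∈T^{(1)}} Π_{x∈B(y), x≠y} χ({|U(y,x) − 1| < ε₀}) ρ(U)»* (FIXED ε₀), read
with the loop variables `U(Γ ∪ [x,x′] ∪ (−Γ′) ∪ (−c))` of the averaging of record ((0.4) p. 253, `BlockAveraging.loopHol`): `1` iff EVERY loop variable at
EVERY coarse bond is `ε₀`-close to the identity (`BlockAveraging.Small` at `δ := ε₀`), `0` otherwise. [cite: Balaban1987RG1, (0.16) p.255 and (0.4) p.253] -/
def chiFix016OfRecord (ε₀ : ℝ) (K k : ℕ) : Density (F.P K) k (SU N) :=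
  fun U => if ∀ (c : PBond (F.P K) (k + 1)) (i : BlockAveraging.Idx (F.P K)), GaugeGroup.dist1 (BlockAveraging.loopHol U c i) < ε₀ then 1 else 0

variable {F N}

/-- `χ^{(0.16)} = 1` iff all loop variables are `ε₀`-small. [cite: Balaban1987RG1, (0.16) p.255] -/
theorem chiFix016OfRecord_eq_one_iff (ε₀ : ℝ) (K k : ℕ) (U : GaugeField (F.P K) k (SU N)) :
    chiFix016OfRecord F N ε₀ K k U = 1 ↔
      ∀ (c : PBond (F.P K) (k + 1)) (i : BlockAveraging.Idx (F.P K)), GaugeGroup.dist1 (BlockAveraging.loopHol U c i) < ε₀ := by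
  unfold chiFix016OfRecord
  split_ifs with h
  · exact ⟨fun _ => h, fun _ => rfl⟩
  · exact ⟨fun h0 => absurd h0 zero_ne_one, fun h' => absurd h' h⟩

/-- `0 ≤ χ^{(0.16)} ≤ 1`. [cite: Balaban1987RG1, (0.16) p.255 (bookkeeping)] -/
theorem chiFix016OfRecord_mem_Icc (ε₀ : ℝ) (K k : ℕ) (U : GaugeField (F.P K) k (SU N)) :
    chiFix016OfRecord F N ε₀ K k U ∈ Set.Icc (0 : ℝ) 1 := by
  unfold chiFix016OfRecord
  split_ifs
  · exact ⟨zero_le_one, le_rfl⟩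
  · exact ⟨le_rfl, zero_le_one⟩

/-! ## §3. The β-slot re-keyings: the TYPE of def-B's χ argument, COUPLING-BLIND by typing -/

variable (F N)

/-- **THE β-SLOT χ OF RECORD** (SECOND printed form, p. 259 l.18–19 — the template owner def-R's keying; its measurability is a THEOREM,
`measurable_chiFixAltOfRecord`): the type `(K : ℕ) → (ℕ → ℝ) → (k : ℕ) → Density (F.P K) k (SU N)` of def-B's χ argument (`effActionH ∕ mergedTerm ∕
mergedTermFamilyMat`) and of Stage 8's `chi7 θ`, filled with `chiFixAltOfRecord` — the coupling sequence is IGNORED. [cite: Balaban1987RG1, (0.19) p.256 and p.259] -/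
def chiFixed7 (ν : Stage7Numerics) : (K : ℕ) → (ℕ → ℝ) → (k : ℕ) → Density (F.P K) k (SU N) :=
  fun K _ k => chiFixAltOfRecord F N ν K k

/-- The same keyed on the FIRST printed form (over node00-def-B's background `U_k(V)`; measurability only conditional, `measurable_chiFixOfRecord_of`).
[cite: Balaban1987RG1, (0.19) p.256 and p.259] -/
def chiFixedBG7 (ν : Stage7Numerics) : (K : ℕ) → (ℕ → ℝ) → (k : ℕ) → Density (F.P K) k (SU N) :=
  fun K _ k => chiFixOfRecord F N ν K k

/-- **COUPLING-BLIND BY TYPING**: the β-slot χ of record does not read the coupling sequence (`rfl`) — the located repair of «χ via `RkOfRecord` makes the tree's β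
g-discontinuous» for the χ input. [cite: Balaban1987RG1, p.259 (ε₀ a fixed constant; Thm 3 p.264)] -/
theorem chiFixed7_flowBlind (ν : Stage7Numerics) (K : ℕ) (g g' : ℕ → ℝ) : chiFixed7 F N ν K g = chiFixed7 F N ν K g' := rfl

/-- Coupling-blind, first-form keying (`rfl`). [cite: Balaban1987RG1, p.259] -/
theorem chiFixedBG7_flowBlind (ν : Stage7Numerics) (K : ℕ) (g g' : ℕ → ℝ) : chiFixedBG7 F N ν K g = chiFixedBG7 F N ν K g' := rfl

/-- Unfolding of the slot at a run (`rfl`). [cite: Balaban1987RG1, (0.19) p.256 (bookkeeping)] -/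
theorem chiFixed7_apply (ν : Stage7Numerics) (K : ℕ) (g : ℕ → ℝ) (k : ℕ) : chiFixed7 F N ν K g k = chiFixAltOfRecord F N ν K k := rfl

/-- Unfolding of the first-form slot at a run (`rfl`). [cite: Balaban1987RG1, (0.19) p.256 (bookkeeping)] -/
theorem chiFixedBG7_apply (ν : Stage7Numerics) (K : ℕ) (g : ℕ → ℝ) (k : ℕ) : chiFixedBG7 F N ν K g k = chiFixOfRecord F N ν K k := rfl

/-- Values of the β-slot χ lie in `{0, 1}` ⊆ `[0, 1]`. [cite: Balaban1987RG1, p.259 (bookkeeping)] -/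
theorem chiFixed7_nonneg (ν : Stage7Numerics) (K : ℕ) (g : ℕ → ℝ) (k : ℕ) (V : GaugeField (F.P K) k (SU N)) : 0 ≤ chiFixed7 F N ν K g k V :=
  chiFixAltOfRecord_nonneg ν K k V

/-- **The β-slot χ of record is MEASURABLE at every run and step** (a THEOREM — what a `measChi`-type displayed hypothesis of a later record is discharged by).
[cite: Balaban1987RG1, p.259 (bookkeeping)] -/
theorem measurable_chiFixed7 (ν : Stage7Numerics) (K : ℕ) (g : ℕ → ℝ) (k : ℕ) : Measurable (chiFixed7 F N ν K g k) :=
  measurable_chiFixAltOfRecord ν K k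

/-! ## §4. Stage 8's β of record with ONLY the χ slot swapped (offered to the next record's owner) -/

/-- **`betaOfRecord₈χ θ`** — `Record8.betaOfRecord₈ θ` with the χ slot `chi7 θ` replaced by the fixed-threshold, measurable `chiFixed7 θ.ν` (second printed form; same merged term family of
record, background radius `εbg`, chart `(ρ8, bV)`, base histories `v₀`, box radius `γ`).  OFFERED, bound by no record.  χ-LAYER SWAP ONLY — the T-side of β
(Stage 8's `effActionH` over the Stage-5 transport `TrhoOfRecord`) stays version-valued until def-B's `TermTowerOfRecord` (pub-ymgap plan (I3-version), def-B
answer (a)); this definition alone does NOT unflag the β layer. [cite: Balaban1987RG1, (1.20)–(1.22) p.264 and p.259] -/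
def betaOfRecord₈χ (θ : Stage8Params F N) : HBeta :=
  letI := θ.instVβ₁; letI := θ.instVβ₂; letI := θ.instιβ
  betaOfMerged (betaMerged F (mergedTermFamilyMat F N (chiFixed7 F N θ.ν) θ.εbg) θ.ρ8 θ.bV)
    (beta0OfMerged (betaMerged F (mergedTermFamilyMat F N (chiFixed7 F N θ.ν) θ.εbg) θ.ρ8 θ.bV) θ.v₀) θ.γ

/-- The printed one-loop split holds for `betaOfRecord₈χ` BY CONSTRUCTION (as at Stage 8: `oneLoopSplit_betaOfMerged`). [cite: Balaban1987RG1, (2.12)–(2.14) p.268 (bookkeeping)] -/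
def oneLoopSplit_betaOfRecord₈χ (θ : Stage8Params F N) : B12Beta.OneLoopSplit (betaOfRecord₈χ F N θ) := by
  unfold betaOfRecord₈χ
  exact oneLoopSplit_betaOfMerged _ _ _

/-- The zero-chart collapse is CHART-side and transfers verbatim: at `ρ8 = 0`, `betaOfRecord₈χ θ = zeroHBeta` (`Record8Inhabited.betaMerged_zeroChart`) — so the
chart clause of `Record8Chart` remains what excludes it; the χ swap neither causes nor cures it. [cite: Balaban1987RG1, (1.20)–(1.22) p.264 (bookkeeping)] -/
theorem betaOfRecord₈χ_of_zeroChart (θ : Stage8Params F N) (h : letI := θ.instVβ₁; letI := θ.instVβ₂; θ.ρ8 = 0) :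
    betaOfRecord₈χ F N θ = zeroHBeta := by
  letI := θ.instVβ₁; letI := θ.instVβ₂; letI := θ.instιβ
  unfold betaOfRecord₈χ
  rw [h, Record8Inhabited.betaMerged_zeroChart, Record8Inhabited.beta0OfMerged_zeroHBeta, Record8Inhabited.betaOfMerged_zeroHBeta]

end Literature.MathematicalPhysics.QuantumFieldTheory.Balaban1983to89.Node00

end
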